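import Summits.Langlands.Langlands.Theorems.ParityBlindBianchiTwoAdicBianchiProModularityLevelSupportDevissage
import HarnessLib

/-!
# `TwoAdicBianchiProModularityLevel` (crux stmt-Langlands-15110, route `ParityBlindBianchi`) —
# RESIDUAL LEVEL CHANGE IN INDEX TWO: `0 → Fun_L → Fun_{L'} → Fun_L → 0` and the descent of Hecke
# supports to the smaller level

Generic vocabulary of `ArithmeticQuotientCohomology` (`Γ → 𝒢`, levels `L' ≤ L`, coefficients `M`,
Hecke elements `δ : J → 𝒢`), the two-level operators of `ArithmeticQuotientHeckeTwoLevel` /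
`ArithmeticQuotientTransfer` (transfer `tr = [L 1 L']`, `tr ∘ res = [L:L']`, `res ∘ tr = ∑_s T_s`) and
the support dévissage of `…SupportDevissage` ("`χ mod 𝔭` is supported on `H`": every non-commutative
polynomial in the operators vanishing on `H` has `P(χ) ∈ 𝔭`, written out in full).  For `L' ≤ L` of
INDEX TWO — encoded by a transversal `{1, s₀}` of `L 1 L'/L'`, `s₀ ≠ 1` — we prove:

* `heckeFun₂_one_apply_of_pair`: `(tr f)(xL) = f(xL') + f(x s₀ L')`; the fibres of `𝒢/L' → 𝒢/L` are the
  pairs `{xL', x s₀ L'}` (`eq_or_eq_of_quotientMapOfLE_eq`, `mk_ne_mk_mul`);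
* `levelTwo_shortExact`: for coefficients with `m + m = 0` (e.g. `k/ϖ` with `2 ∈ (ϖ)`), the sequence
  `0 → Fun(𝒢/L, M) —res→ Fun(𝒢/L', M) —tr→ Fun(𝒢/L, M) → 0` of coefficient representations is SHORT
  EXACT (any index-two pair, no normality: `tr` is onto, and `ker tr` = functions constant on the fibres);
* `heckeFun_comm_of_conj`, `heckeRepHom_comp_transfer`: if `L` normalises `L'` and the Hecke element
  `g` commutes with `s₀` and has corresponding double cosets at the two levels, then `[L' g L']` commutes
  with `[L' s₀ L'] = (· s₀)` and the transfer is Hecke equivariant, `[L' g L'] ≫ tr = tr ≫ [L g L]`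
  (after the injective `res`: `T'(1 + T_{s₀}) = (1 + T_{s₀})T'`);
* `exists_supp_of_supp_levelTwo` (registered closed form `levelTwo_supp_devissage`): hence, by the long
  exact sequence (`supp_X₂_or_X₃_of_supp_X₁`: `Supp Hⁱ(X_L) ⊆ Supp Hⁱ(X_{L'}) ∪ Supp Hⁱ⁻¹(X_L)`) and
  induction on the degree, **residual support at level `L` in degree `i` gives residual support at
  level `L'` in some degree `≤ i`** — the `2`-primary (Hochschild–Serre) half of "mod-`𝔪` eigensystems
  of level `L` occur at every smaller level", complementary to restriction–transfer (odd index,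
  `…ResidualLevelChangeCrux`).  Bearing on stub B of the crux: its tame level `U₀` may be deepened at the
  odd places of `S₀` along index-two and odd-index steps without losing the residual occurrence of `σ̄`.

Sorry-free, definition-free; lead c10 (line `Sketch`, cycle 11).

## References

* K. S. Brown, *Cohomology of Groups*, GTM 87 (1982), III §6 Prop. 6.1, §9 Prop. 9.5
  [Brown1982CohomologyGroups].
-/

noncomputable section

set_option linter.dupNamespace false

namespace Summit.Langlands.Langlands.Theorems.TwoAdicBianchiProModularityLevel

open CategoryTheory Literature.NumberTheory.Automorphic

universe v

/-! ### Residual level change in index two -/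

section LevelChange

variable {k : Type} [CommRing k] {Γ 𝒢 : Type} [Group Γ] [Group 𝒢] (ι : Γ →* 𝒢)
  {L L' : Subgroup 𝒢} (M : Type) [AddCommGroup M] [Module k M]
  {J : Type v} (δ : J → 𝒢) (χ : J → k) {𝔭 : Ideal k}

/-! #### Index two: the short exact sequence `0 → Fun_L → Fun_{L'} → Fun_L → 0` -/

variable {M} in
/-- With a transversal `{1, s₀}` of `L / L'` (`L' ≤ L`): `s₀ ∈ L`. [folklore] -/
theorem mem_of_pair_bijOn (h : L' ≤ L) {s₀ : 𝒢}
    (hS : Set.BijOn (fun s : 𝒢 => (s : 𝒢 ⧸ L')) {1, s₀} (ArithmeticQuotient.doubleCosetQuot₂ L L' 1)) :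
    s₀ ∈ L := by
  have hs : ((s₀ : 𝒢) : 𝒢 ⧸ L') ∈ ArithmeticQuotient.doubleCosetQuot₂ L L' 1 := hS.mapsTo (by simp)
  rw [ArithmeticQuotient.doubleCosetQuot₂_one_eq_range] at hs
  obtain ⟨l, hl⟩ := hs
  have hls : (l : 𝒢)⁻¹ * s₀ ∈ L' := QuotientGroup.eq.1 hl
  simpa using mul_mem l.2 (h hls)

variable {M} in
/-- With a transversal `{1, s₀}` of `L / L'`, the double coset `L 1 L' / L'` is the pair
`{L', s₀ L'}`. [folklore] -/
theorem doubleCosetQuot₂_one_eq_pair {s₀ : 𝒢}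
    (hS : Set.BijOn (fun s : 𝒢 => (s : 𝒢 ⧸ L')) {1, s₀} (ArithmeticQuotient.doubleCosetQuot₂ L L' 1)) :
    ArithmeticQuotient.doubleCosetQuot₂ L L' (1 : 𝒢) = {((1 : 𝒢) : 𝒢 ⧸ L'), ((s₀ : 𝒢) : 𝒢 ⧸ L')} := by
  rw [← hS.image_eq, Set.image_pair]

variable {M} in
/-- A transversal `{1, s₀}` of `L/L'` makes the fibres of `𝒢/L' → 𝒢/L` the pairs `{xL', x s₀ L'}`.
[folklore] -/
theorem eq_or_eq_of_quotientMapOfLE_eq (h : L' ≤ L) {s₀ : 𝒢}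
    (hS : Set.BijOn (fun s : 𝒢 => (s : 𝒢 ⧸ L')) {1, s₀} (ArithmeticQuotient.doubleCosetQuot₂ L L' 1))
    (x : 𝒢) (c : 𝒢 ⧸ L') (hc : Subgroup.quotientMapOfLE h c = (x : 𝒢 ⧸ L)) :
    c = (x : 𝒢 ⧸ L') ∨ c = ((x * s₀ : 𝒢) : 𝒢 ⧸ L') := by
  induction c using QuotientGroup.induction_on with
  | H z =>
    rw [Subgroup.quotientMapOfLE_apply_mk, QuotientGroup.eq] at hc
    have hc' : x⁻¹ * z ∈ L := by
      rw [show x⁻¹ * z = (z⁻¹ * x)⁻¹ by group]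
      exact L.inv_mem hc
    have hmem : (((x⁻¹ * z : 𝒢)) : 𝒢 ⧸ L') ∈ ArithmeticQuotient.doubleCosetQuot₂ L L' 1 := by
      rw [ArithmeticQuotient.doubleCosetQuot₂_one_eq_range]
      exact ⟨⟨x⁻¹ * z, hc'⟩, rfl⟩
    rw [doubleCosetQuot₂_one_eq_pair hS, Set.mem_insert_iff, Set.mem_singleton_iff, QuotientGroup.eq,
      QuotientGroup.eq] at hmem
    rcases hmem with hsz | hsz
    · left
      refine QuotientGroup.eq.2 ?_
      rw [show z⁻¹ * x = (x⁻¹ * z)⁻¹ * 1 by group]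
      exact hsz
    · right
      refine QuotientGroup.eq.2 ?_
      rw [show z⁻¹ * (x * s₀) = (x⁻¹ * z)⁻¹ * s₀ by group]
      exact hsz

variable {M} in
/-- With a transversal `{1, s₀}` of `L/L'` (`s₀ ≠ 1`), `xL' ≠ x s₀ L'`. [folklore] -/
theorem mk_ne_mk_mul {s₀ : 𝒢} (hs₀ : s₀ ≠ 1)
    (hS : Set.BijOn (fun s : 𝒢 => (s : 𝒢 ⧸ L')) {1, s₀} (ArithmeticQuotient.doubleCosetQuot₂ L L' 1))
    (x : 𝒢) : (x : 𝒢 ⧸ L') ≠ ((x * s₀ : 𝒢) : 𝒢 ⧸ L') := by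
  intro he
  have h1 : ((1 : 𝒢) : 𝒢 ⧸ L') = ((s₀ : 𝒢) : 𝒢 ⧸ L') := by
    rw [QuotientGroup.eq] at he ⊢
    simpa using he
  exact hs₀ (hS.injOn (by simp) (by simp) h1).symm

/-- **The transfer in index two**: with a transversal `{1, s₀}` of `L/L'` (`s₀ ≠ 1`),
`([L 1 L'] f)(xL) = f(xL') + f(x s₀ L')`. [cite: Brown1982CohomologyGroups, III §9] -/
theorem heckeFun₂_one_apply_of_pair {s₀ : 𝒢} (hs₀ : s₀ ≠ 1)
    (hS : Set.BijOn (fun s : 𝒢 => (s : 𝒢 ⧸ L')) {1, s₀} (ArithmeticQuotient.doubleCosetQuot₂ L L' 1))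
    (f : (𝒢 ⧸ L') → M) (x : 𝒢) :
    ArithmeticQuotient.heckeFun₂ k L L' 1 M f (x : 𝒢 ⧸ L) =
      f (x : 𝒢 ⧸ L') + f ((x * s₀ : 𝒢) : 𝒢 ⧸ L') := by
  classical
  have himg := doubleCosetQuot₂_one_eq_pair hS
  have hfin : (ArithmeticQuotient.doubleCosetQuot₂ L L' (1 : 𝒢)).Finite := by
    rw [himg]
    exact Set.toFinite _
  have hne : ((1 : 𝒢) : 𝒢 ⧸ L') ≠ ((s₀ : 𝒢) : 𝒢 ⧸ L') := fun he =>
    hs₀ (hS.injOn (by simp) (by simp) he).symm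
  rw [ArithmeticQuotient.heckeFun₂_apply_coe k L L' 1 M f x hfin]
  have hset : hfin.toFinset = {((1 : 𝒢) : 𝒢 ⧸ L'), ((s₀ : 𝒢) : 𝒢 ⧸ L')} := by
    refine Finset.ext fun d => ?_
    rw [Set.Finite.mem_toFinset, himg, Finset.mem_insert, Finset.mem_singleton, Set.mem_insert_iff,
      Set.mem_singleton_iff]
  rw [hset, Finset.sum_pair hne, MulAction.Quotient.smul_coe, MulAction.Quotient.smul_coe,
    smul_eq_mul, smul_eq_mul, mul_one]

/-- `2 = [L : L']` kills the coefficients: `pull-back ≫ transfer = 0` on `Fun(𝒢/L, M)` when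
`m + m = 0` in `M`. [folklore] -/
theorem pullbackHom_comp_heckeRepHom₂_one_eq_zero (h : L' ≤ L) {s₀ : 𝒢} (hs₀ : s₀ ≠ 1)
    (hS : Set.BijOn (fun s : 𝒢 => (s : 𝒢 ⧸ L')) {1, s₀} (ArithmeticQuotient.doubleCosetQuot₂ L L' 1))
    (h2 : ∀ m : M, m + m = 0) :
    ArithmeticQuotient.pullbackHom k ι M h ≫ ArithmeticQuotient.heckeRepHom₂ k L L' 1 M ι = 0 := by
  refine Rep.hom_ext (Representation.IntertwiningMap.ext (LinearMap.ext fun F => funext fun c => ?_))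
  induction c using QuotientGroup.induction_on with
  | H x =>
    change ArithmeticQuotient.heckeFun₂ k L L' 1 M ((ArithmeticQuotient.pullbackHom k ι M h).hom F)
      (x : 𝒢 ⧸ L) = 0
    rw [heckeFun₂_one_apply_of_pair M hs₀ hS, ArithmeticQuotient.pullbackHom_apply,
      ArithmeticQuotient.pullbackHom_apply, Subgroup.quotientMapOfLE_apply_mk,
      Subgroup.quotientMapOfLE_apply_mk]
    have hx : ((x * s₀ : 𝒢) : 𝒢 ⧸ L) = (x : 𝒢 ⧸ L) :=
      QuotientGroup.eq.2 (by simpa using L.inv_mem (mem_of_pair_bijOn h hS))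
    rw [hx]
    exact h2 _

/-- **`0 → Fun(𝒢/L, M) → Fun(𝒢/L', M) → Fun(𝒢/L, M) → 0` is short exact in index two** (maps:
pull-back and transfer `[L 1 L']`; `{1, s₀}` a transversal of `L/L'`, `s₀ ≠ 1`; coefficients with
`m + m = 0`): the transfer is onto (a function supported on one chosen point of each fibre is a
pre-image) and its kernel consists of the functions constant on the fibres `{xL', x s₀ L'}`, i.e. of
the pull-backs. [cite: Brown1982CohomologyGroups, III §9] -/
theorem levelTwo_shortExact (h : L' ≤ L) {s₀ : 𝒢} (hs₀ : s₀ ≠ 1)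
    (hS : Set.BijOn (fun s : 𝒢 => (s : 𝒢 ⧸ L')) {1, s₀} (ArithmeticQuotient.doubleCosetQuot₂ L L' 1))
    (h2 : ∀ m : M, m + m = 0) :
    (ShortComplex.mk (ArithmeticQuotient.pullbackHom k ι M h)
      (ArithmeticQuotient.heckeRepHom₂ k L L' 1 M ι)
      (pullbackHom_comp_heckeRepHom₂_one_eq_zero ι M h hs₀ hS h2)).ShortExact where
  exact := by
    classical
    refine (forget₂ (Rep k Γ) (ModuleCat k)).reflects_exact_of_faithful _ <|
      (ShortComplex.moduleCat_exact_iff _).2 fun f hf => ?_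
    change (𝒢 ⧸ L') → M at f
    have hf' : ∀ x : 𝒢, f (x : 𝒢 ⧸ L') + f ((x * s₀ : 𝒢) : 𝒢 ⧸ L') = 0 := fun x => by
      have := congr_fun hf (x : 𝒢 ⧸ L)
      rw [← heckeFun₂_one_apply_of_pair (k := k) M hs₀ hS f x]
      exact this
    -- `f` is constant on the fibres
    have hconst : ∀ x : 𝒢, f ((x * s₀ : 𝒢) : 𝒢 ⧸ L') = f (x : 𝒢 ⧸ L') := fun x => by
      rw [eq_neg_of_add_eq_zero_right (hf' x), neg_eq_of_add_eq_zero_right (h2 _)]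
    refine ⟨fun y => f ((y.out : 𝒢) : 𝒢 ⧸ L'), funext fun c => ?_⟩
    change f (((Subgroup.quotientMapOfLE h c).out : 𝒢) : 𝒢 ⧸ L') = f c
    induction c using QuotientGroup.induction_on with
    | H z =>
      have hπ : Subgroup.quotientMapOfLE h ((((z : 𝒢 ⧸ L)).out : 𝒢) : 𝒢 ⧸ L') = (z : 𝒢 ⧸ L) := by
        rw [Subgroup.quotientMapOfLE_apply_mk]
        exact QuotientGroup.out_eq' _
      rcases eq_or_eq_of_quotientMapOfLE_eq h hS z _ hπ with e | e
      · rw [Subgroup.quotientMapOfLE_apply_mk, e]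
      · rw [Subgroup.quotientMapOfLE_apply_mk, e, hconst]
  mono_f := (Rep.mono_iff_injective _).2 fun F₁ F₂ hF => funext fun y => by
    induction y using QuotientGroup.induction_on with
    | H x => exact congr_fun hF (x : 𝒢 ⧸ L')
  epi_g := by
    classical
    refine (Rep.epi_iff_surjective _).2 fun F => ?_
    -- pre-image: `F ∘ π` restricted to the chosen point `σ(y) = y.out L'` of each fibre
    refine ⟨fun c => if c = (((Subgroup.quotientMapOfLE h c).out : 𝒢) : 𝒢 ⧸ L') then
        F (Subgroup.quotientMapOfLE h c) else 0, funext fun y => ?_⟩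
    induction y using QuotientGroup.induction_on with
    | H x =>
      change ArithmeticQuotient.heckeFun₂ k L L' 1 M _ (x : 𝒢 ⧸ L) = F (x : 𝒢 ⧸ L)
      rw [heckeFun₂_one_apply_of_pair M hs₀ hS]
      have hx : ((x * s₀ : 𝒢) : 𝒢 ⧸ L) = (x : 𝒢 ⧸ L) :=
        QuotientGroup.eq.2 (by simpa using L.inv_mem (mem_of_pair_bijOn h hS))
      simp only [Subgroup.quotientMapOfLE_apply_mk, hx]
      have hπ : Subgroup.quotientMapOfLE h ((((x : 𝒢 ⧸ L)).out : 𝒢) : 𝒢 ⧸ L') = (x : 𝒢 ⧸ L) := by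
        rw [Subgroup.quotientMapOfLE_apply_mk]
        exact QuotientGroup.out_eq' _
      have hne := mk_ne_mk_mul hs₀ hS x
      rcases eq_or_eq_of_quotientMapOfLE_eq h hS x _ hπ with e | e
      · rw [e, if_pos rfl, if_neg (Ne.symm hne), add_zero]
      · rw [e, if_neg hne, if_pos rfl, zero_add]

/-! #### Index two: Hecke equivariance of the transfer -/

variable {M} in
/-- Right multiplication by an element `s₀` normalising `L'` is well defined on `𝒢 ⧸ L'`; the Hecke
operator `[L' s₀ L']` is then `f ↦ f(· s₀)`.  Here: if moreover `s₀` commutes with `g`, then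
`[L' g L']` commutes with `[L' s₀ L']` (conjugation by `s₀` permutes `L' g L' / L'`). [folklore] -/
theorem heckeFun_comm_of_conj {s₀ : 𝒢} (hn : ∀ y ∈ L', s₀⁻¹ * y * s₀ ∈ L')
    (hn' : ∀ y ∈ L', s₀ * y * s₀⁻¹ ∈ L') (g : 𝒢) (hsg : s₀ * g = g * s₀)
    (hfin : (ArithmeticQuotient.doubleCosetQuot L' g).Finite) :
    ArithmeticQuotient.heckeFun k L' g M ∘ₗ ArithmeticQuotient.heckeFun k L' s₀ M =
      ArithmeticQuotient.heckeFun k L' s₀ M ∘ₗ ArithmeticQuotient.heckeFun k L' g M := by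
  classical
  -- right multiplication by `s₀` on `𝒢 ⧸ L'`
  let ρ : 𝒢 ⧸ L' → 𝒢 ⧸ L' := fun c => Quotient.map' (· * s₀) (fun a b hab => by
    rw [QuotientGroup.leftRel_apply] at hab ⊢
    rw [show (a * s₀)⁻¹ * (b * s₀) = s₀⁻¹ * (a⁻¹ * b) * s₀ by group]
    exact hn _ hab) c
  have hρ : ∀ w : 𝒢, ρ (w : 𝒢 ⧸ L') = ((w * s₀ : 𝒢) : 𝒢 ⧸ L') := fun w => rfl
  have hTs : ∀ (f : (𝒢 ⧸ L') → M) (c : 𝒢 ⧸ L'),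
      ArithmeticQuotient.heckeFun k L' s₀ M f c = f (ρ c) := fun f c => by
    induction c using QuotientGroup.induction_on with
    | H w => rw [ArithmeticQuotient.heckeFun_apply_mk_of_conj k M hn f w, hρ]
  have hρsmul : ∀ (z : 𝒢) (c : 𝒢 ⧸ L'), ρ (z • c) = z • ρ c := fun z c => by
    induction c using QuotientGroup.induction_on with
    | H w =>
      rw [MulAction.Quotient.smul_coe, smul_eq_mul, hρ, hρ, MulAction.Quotient.smul_coe, smul_eq_mul,
        mul_assoc]
  -- conjugation by `s₀` permutes `L' g L' / L'`: `ρ(L' g L'/L') = s₀ • (L' g L'/L')`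
  have himage : hfin.toFinset.image ρ = hfin.toFinset.image (fun c => s₀ • c) := by
    refine Finset.ext fun c => ?_
    simp only [Finset.mem_image, Set.Finite.mem_toFinset]
    constructor
    · rintro ⟨_, ⟨l, rfl⟩, rfl⟩
      refine ⟨(⟨s₀⁻¹ * l * s₀, hn _ l.2⟩ : L') • (g : 𝒢 ⧸ L'), ⟨_, rfl⟩, ?_⟩
      change s₀ • (((s₀⁻¹ * l * s₀ : 𝒢)) • (g : 𝒢 ⧸ L')) = ρ ((l : 𝒢) • (g : 𝒢 ⧸ L'))
      rw [MulAction.Quotient.smul_coe, MulAction.Quotient.smul_coe, MulAction.Quotient.smul_coe,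
        smul_eq_mul, smul_eq_mul, smul_eq_mul, hρ]
      congr 1
      rw [← mul_assoc, ← mul_assoc, mul_assoc _ s₀ g, hsg]
      group
    · rintro ⟨_, ⟨l, rfl⟩, rfl⟩
      refine ⟨(⟨s₀ * l * s₀⁻¹, hn' _ l.2⟩ : L') • (g : 𝒢 ⧸ L'), ⟨_, rfl⟩, ?_⟩
      change ρ (((s₀ * l * s₀⁻¹ : 𝒢)) • (g : 𝒢 ⧸ L')) = s₀ • ((l : 𝒢) • (g : 𝒢 ⧸ L'))
      rw [MulAction.Quotient.smul_coe, MulAction.Quotient.smul_coe, MulAction.Quotient.smul_coe,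
        smul_eq_mul, smul_eq_mul, smul_eq_mul, hρ]
      congr 1
      rw [mul_assoc _ g s₀, ← hsg]
      group
  have hρinj : Function.Injective ρ := fun a b hab => by
    induction a using QuotientGroup.induction_on with
    | H a =>
      induction b using QuotientGroup.induction_on with
      | H b =>
        rw [hρ, hρ, QuotientGroup.eq] at hab
        refine QuotientGroup.eq.2 ?_
        have := hn' _ hab
        rwa [show s₀ * ((a * s₀)⁻¹ * (b * s₀)) * s₀⁻¹ = a⁻¹ * b by group] at this
  refine LinearMap.ext fun f => funext fun c => ?_
  induction c using QuotientGroup.induction_on with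
  | H z =>
    rw [LinearMap.comp_apply, LinearMap.comp_apply,
      hTs (ArithmeticQuotient.heckeFun k L' g M f) (z : 𝒢 ⧸ L'), hρ,
      ArithmeticQuotient.heckeFun_apply_coe k L' M g f (z * s₀) hfin,
      ArithmeticQuotient.heckeFun_apply_coe k L' M g _ z hfin]
    have e1 : ∑ d ∈ hfin.toFinset, ArithmeticQuotient.heckeFun k L' s₀ M f (z • d) =
        ∑ c ∈ hfin.toFinset.image ρ, f (z • c) := by
      rw [Finset.sum_image (fun a _ b _ hab => hρinj hab)]
      exact Finset.sum_congr rfl fun d _ => by rw [hTs, hρsmul]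
    have e2 : ∑ d ∈ hfin.toFinset, f ((z * s₀) • d) =
        ∑ c ∈ hfin.toFinset.image (fun c => s₀ • c), f (z • c) := by
      rw [Finset.sum_image (fun a _ b _ hab => smul_left_cancel s₀ hab)]
      exact Finset.sum_congr rfl fun d _ => by rw [mul_smul]
    rw [e1, e2, himage]

/-- **The transfer `[L 1 L']` is Hecke equivariant**: for `L' ≤ L` of index two with transversal
`{1, s₀}`, `L` normalising `L'`, and a Hecke element `g` commuting with `s₀` whose double cosets at
the two levels correspond (`L' g L'/L' → L g L/L` bijective, finite):
`[L' g L'] ≫ [L 1 L'] = [L 1 L'] ≫ [L g L]` on the coefficient representations.  (After the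
injective pull-back both sides become `[L' g L'] (1 + [L' s₀ L'])` resp. `(1 + [L' s₀ L']) [L' g L']`,
by `res ∘ tr = ∑_s T_s` and `T_g ∘ res = res ∘ T_g`.) [cite: Brown1982CohomologyGroups, III §9 Prop. 9.5] -/
theorem heckeRepHom_comp_transfer (h : L' ≤ L) {s₀ : 𝒢} (hs₀ : s₀ ≠ 1)
    (hS : Set.BijOn (fun s : 𝒢 => (s : 𝒢 ⧸ L')) {1, s₀} (ArithmeticQuotient.doubleCosetQuot₂ L L' 1))
    (hN : ∀ l ∈ L, ∀ y ∈ L', l⁻¹ * y * l ∈ L') (g : 𝒢) (hsg : s₀ * g = g * s₀)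
    (hbij : Set.BijOn (Subgroup.quotientMapOfLE h) (ArithmeticQuotient.doubleCosetQuot L' g)
      (ArithmeticQuotient.doubleCosetQuot L g))
    (hfin : (ArithmeticQuotient.doubleCosetQuot L g).Finite) :
    ArithmeticQuotient.heckeRepHom k L' g M ι ≫ ArithmeticQuotient.heckeRepHom₂ k L L' 1 M ι =
      ArithmeticQuotient.heckeRepHom₂ k L L' 1 M ι ≫ ArithmeticQuotient.heckeRepHom k L g M ι := by
  classical
  have hs₀L : s₀ ∈ L := mem_of_pair_bijOn h hS
  have hn : ∀ y ∈ L', s₀⁻¹ * y * s₀ ∈ L' := hN s₀ hs₀L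
  have hn' : ∀ y ∈ L', s₀ * y * s₀⁻¹ ∈ L' := fun y hy => by
    simpa using hN s₀⁻¹ (L.inv_mem hs₀L) y hy
  have hfin' : (ArithmeticQuotient.doubleCosetQuot L' g).Finite :=
    Set.Finite.of_finite_image (hbij.image_eq.symm ▸ hfin) hbij.injOn
  have hS' : Set.BijOn (fun s : 𝒢 => (s : 𝒢 ⧸ L')) (({1, s₀} : Finset 𝒢) : Set 𝒢)
      (ArithmeticQuotient.doubleCosetQuot₂ L L' 1) := by
    rwa [Finset.coe_pair]
  haveI : Mono (ArithmeticQuotient.pullbackHom k ι M h) :=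
    (Rep.mono_iff_injective _).2 fun F₁ F₂ hF => funext fun y => by
      induction y using QuotientGroup.induction_on with
      | H x => exact congr_fun hF (x : 𝒢 ⧸ L')
  have hres := ArithmeticQuotient.heckeRepHom_comp_pullbackHom k ι M h g hbij hfin
  have htr := ArithmeticQuotient.heckeRepHom₂_one_comp_pullbackHom k L L' M ι h hN _ hS'
  have h1 : ArithmeticQuotient.heckeRepHom k L' (1 : 𝒢) M ι = 𝟙 _ :=
    Rep.hom_ext (Representation.IntertwiningMap.ext (ArithmeticQuotient.heckeFun_one k L' M))
  have hcomm : ArithmeticQuotient.heckeRepHom k L' g M ι ≫ ArithmeticQuotient.heckeRepHom k L' s₀ M ι =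
      ArithmeticQuotient.heckeRepHom k L' s₀ M ι ≫ ArithmeticQuotient.heckeRepHom k L' g M ι :=
    Rep.hom_ext (Representation.IntertwiningMap.ext
      (heckeFun_comm_of_conj hn hn' g hsg hfin').symm)
  rw [← cancel_mono (ArithmeticQuotient.pullbackHom k ι M h), Category.assoc, Category.assoc, hres,
    ← Category.assoc (ArithmeticQuotient.heckeRepHom₂ k L L' 1 M ι) (ArithmeticQuotient.pullbackHom k ι M h),
    htr, Finset.sum_pair hs₀.symm, h1, Preadditive.comp_add, Preadditive.add_comp, Category.comp_id,
    Category.id_comp, hcomm]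


/-! #### Index two: support descends to the smaller level, in some lower-or-equal degree -/

/-- **Index two: residual support at level `L` gives residual support at level `L'` in some degree
`≤ i`.**  For `L' ≤ L` of index two (transversal `{1, s₀}`, `L` normalising `L'`), coefficients with
`m + m = 0`, Hecke elements `δ j` commuting with `s₀` whose double cosets at the two levels correspond,
and `𝔭` prime: by the long exact sequence of `0 → Fun_L → Fun_{L'} → Fun_L → 0`,
`Supp Hⁱ(X_L) ⊆ Supp Hⁱ(X_{L'}) ∪ Supp Hⁱ⁻¹(X_L)`, and induction on `i`.  This is the `2`-primary
(Hochschild–Serre) half of "systems of eigenvalues mod `𝔪` at level `L` occur at every smaller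
level", the half not covered by restriction–transfer.
[cite: Brown1982CohomologyGroups, III §6 Prop. 6.1, §9 Prop. 9.5] -/
theorem exists_supp_of_supp_levelTwo (h : L' ≤ L) {s₀ : 𝒢} (hs₀ : s₀ ≠ 1)
    (hS : Set.BijOn (fun s : 𝒢 => (s : 𝒢 ⧸ L')) {1, s₀} (ArithmeticQuotient.doubleCosetQuot₂ L L' 1))
    (hN : ∀ l ∈ L, ∀ y ∈ L', l⁻¹ * y * l ∈ L') (h2 : ∀ m : M, m + m = 0)
    (hsg : ∀ j, s₀ * δ j = δ j * s₀)
    (hbij : ∀ j, Set.BijOn (Subgroup.quotientMapOfLE h) (ArithmeticQuotient.doubleCosetQuot L' (δ j))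
      (ArithmeticQuotient.doubleCosetQuot L (δ j)))
    (hfin : ∀ j, (ArithmeticQuotient.doubleCosetQuot L (δ j)).Finite) (h𝔭 : 𝔭.IsPrime) (i : ℕ)
    (hs : ∀ P : FreeAlgebra k J,
      FreeAlgebra.lift k (fun j => ArithmeticQuotient.heckeEnd k L (δ j) M ι i) P = 0 →
        FreeAlgebra.lift k χ P ∈ 𝔭) :
    ∃ i' ≤ i, ∀ P : FreeAlgebra k J,
      FreeAlgebra.lift k (fun j => ArithmeticQuotient.heckeEnd k L' (δ j) M ι i') P = 0 →
        FreeAlgebra.lift k χ P ∈ 𝔭 := by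
  induction i using Nat.strong_induction_on with
  | _ i ih =>
    rcases supp_X₂_or_X₃_of_supp_X₁ (levelTwo_shortExact ι M h hs₀ hS h2)
        (fun j => { τ₁ := ArithmeticQuotient.heckeRepHom k L (δ j) M ι
                    τ₂ := ArithmeticQuotient.heckeRepHom k L' (δ j) M ι
                    τ₃ := ArithmeticQuotient.heckeRepHom k L (δ j) M ι
                    comm₁₂ := ArithmeticQuotient.heckeRepHom_comp_pullbackHom k ι M h (δ j) (hbij j) (hfin j)
                    comm₂₃ := heckeRepHom_comp_transfer ι M h hs₀ hS hN (δ j) (hsg j) (hbij j) (hfin j) })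
        χ h𝔭 i hs with h₂ | ⟨i₀, hi₀, h₃⟩
    · exact ⟨i, le_rfl, h₂⟩
    · obtain ⟨i', hi', h'⟩ := ih i₀ (by omega) h₃
      exact ⟨i', by omega, h'⟩

/-- **Residual level change in index two** (registered sub-goal; the closed form of
`exists_supp_of_supp_levelTwo`). [cite: Brown1982CohomologyGroups, III §6 Prop. 6.1, §9 Prop. 9.5] -/
theorem levelTwo_supp_devissage : ∀ (k : Type) [CommRing k] (Γ 𝒢 : Type) [Group Γ] [Group 𝒢]
    (ι : Γ →* 𝒢) (L L' : Subgroup 𝒢) (h : L' ≤ L) (M : Type) [AddCommGroup M] [Module k M]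
    (J : Type) (δ : J → 𝒢) (χ : J → k) (𝔭 : Ideal k) (s₀ : 𝒢), s₀ ≠ 1 →
    Set.BijOn (fun s : 𝒢 => (s : 𝒢 ⧸ L')) {1, s₀} (ArithmeticQuotient.doubleCosetQuot₂ L L' 1) →
    (∀ l ∈ L, ∀ y ∈ L', l⁻¹ * y * l ∈ L') → (∀ m : M, m + m = 0) → (∀ j, s₀ * δ j = δ j * s₀) →
    (∀ j, Set.BijOn (Subgroup.quotientMapOfLE h) (ArithmeticQuotient.doubleCosetQuot L' (δ j))
      (ArithmeticQuotient.doubleCosetQuot L (δ j))) →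
    (∀ j, (ArithmeticQuotient.doubleCosetQuot L (δ j)).Finite) → 𝔭.IsPrime → ∀ i : ℕ,
    (∀ P : FreeAlgebra k J,
      FreeAlgebra.lift k (fun j => ArithmeticQuotient.heckeEnd k L (δ j) M ι i) P = 0 →
        FreeAlgebra.lift k χ P ∈ 𝔭) →
    ∃ i' ≤ i, ∀ P : FreeAlgebra k J,
      FreeAlgebra.lift k (fun j => ArithmeticQuotient.heckeEnd k L' (δ j) M ι i') P = 0 →
        FreeAlgebra.lift k χ P ∈ 𝔭 :=
  fun _ _ _ _ _ _ ι _ _ h M _ _ _ δ χ _ _ hs₀ hS hN h2 hsg hbij hfin h𝔭 i hs =>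
    exists_supp_of_supp_levelTwo ι M δ χ h hs₀ hS hN h2 hsg hbij hfin h𝔭 i hs

end LevelChange


end Summit.Langlands.Langlands.Theorems.TwoAdicBianchiProModularityLevel

end
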